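import Summits.BirchSwinnertonDyer.BirchSwinnertonDyer.Theorems.ClassRecordThreeEulerHalvesAtThreeCartanCoverAssembly
import Summits.BirchSwinnertonDyer.BirchSwinnertonDyer.Theorems.ClassRecordThreeEulerHalvesAtThreeCartanTorusCubeCutPSModAssembly
import Summits.BirchSwinnertonDyer.BirchSwinnertonDyer.Theorems.ClassRecordThreeEulerHalvesAtThreeCartanStubF2bResidue
import Summits.BirchSwinnertonDyer.BirchSwinnertonDyer.Theorems.ClassRecordThreeEulerHalvesAtThreeCartanSupplyMonomialNet
import HarnessLib

/-!
# Crux `CartanOnePlaceDegreeLawAtThree` (NUM) — Negative lane: the inputs (D3) and (D4) of line `lattice` are LOAD-BEARING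

Refuter ∕ disprover unit `cdisprove-stmt-BirchSwinnertonDyer-24801-g0` (explicit unit of director-bsd; crux item stmt-BirchSwinnertonDyer-24801,
`CartanCorrespondence.CartanOnePlaceDegreeLawAtThree`, wanted by routes `ClassRecordThree` ∕ `KolyvaginRoadThree`).

Line `Cruxes/CartanOnePlaceDegreeLawAtThree/Lines/lattice.lean` (v2) closes NUM from five cover facts — (A) `CartanCover.CoverReductionExists`
(PROVED, `CartanTransport.Cover.coverReductionExists`), (M) `CartanCover.PeriodLatticeCharacter`, (P+T) `CartanCover.SplitSideSheetAtThree`,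
(D3) `CartanCover.DescentNonsplitAtThree`, (D4) `CartanCover.SaturationAtThree` — through the finite-group dictionary
`CartanSaturatedDictionary.saturatedDictionary_of_coverFacts`. NUM itself and the five facts quantify over a curve `V∕ℚ` of conductor `N` with
Cartan-level parametrisations, objects the tree cannot instantiate, so none of them is attackable by models (crux work file `Disproof.lean`).
What the dictionary CONSUMES at a place `q`, however, is a statement of finite-group algebra — the LATTICE CONTRACT: an integral representation
`ρ` of `GL₂(𝔽_q)` on `Λ = ℤ^d` with character `cubicNewvectorChar q` [(M)], a `ρ`-invariant symmetric positive-definite form `B` and an elliptic `η`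
[(P+T)(i)], torus-fixed vectors `u_S` (split) and `u_C` (non-split, of `η`) [(P+T)(ii)], `u_S ∉ 3Λ` [(P+T)(iii)], `u_C ∉ 3Λ` [(D3)], `(Λ∕3Λ)^G = 0` [(D4)],
a constant `c > 0` and positive naturals `degX0`, `degC` with the two sheet counts `c·B(u_S,u_S) = (q−1)²∕2·degX0`, `c·B(u_C,u_C) = (q²−1)∕2·degC`
[(P+T)(iii)] — and what it RETURNS is the law `ord₃ degX0 = ord₃ degC + 1`. This file decides which clauses of the contract carry the law:

* `latticeLaw_with_saturation` — the full contract implies the law (the tree's `CartanPreDatumOfLattice.exists_degreeData_of_lattice` and the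
  unconditional lattice degree law S-K1′ `CartanF2bResidue.latticeDegreeLawAtThree`); recorded for contrast.
* `latticeLaw_false_without_descent` — drop ONLY «`u_C ∉ 3Λ`» [(D3)]: FALSE. Witness: the tree's supply lattice at `q = 7` with `u_C := 3·w_C`
  (`exists_invertedLaw_in_lattice`: at EVERY prime `q ≠ 3` the law comes out inverted, `ord₃ degX0 + 1 = ord₃ degC`).
* `latticeLaw_false_without_saturation` — drop ONLY «`(Λ∕3Λ)^G = 0`» [(D4)]: FALSE. Witness (`exists_invertedLaw_of_cartanTorusLattice`): at every
  principal-series place `q ≡ 1 (mod 3)`, `q ≥ 5`, the index-`3` sublattice `K = X_M ⊂ Λ` of ANY Cartan torus lattice `Λ` — the OTHER member of the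
  pair {Steinberg-type, `M`-type} of `ℤ`-forms (cartan-f2a's mod-3 line, `CartanTorusCubeCut.PSMod.exists_line`) — with `u_S := w_S ∈ K`, `u_C := 3w_C ∈ K`
  satisfies every other clause (same character by finite index; restricted form; `u_S`, `u_C` primitive IN `K` because `w_S ∉ 3Λ` and `w_C ∉ K`;
  both sheet counts) but `u_C` is a non-zero `G`-fixed vector of `K∕3K`, and S-K1′ for `Λ` turns into the INVERTED law for `K`. Instance `q = 7`.

MEANING (a prover's briefing, not a refutation of NUM). (i) The dictionary cannot absorb (D4): (A)+(M)+(P+T)+(D3) admit counter-models of the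
unsaturated contract at every PS place `q ≡ 1 (mod 3)`, so a proof of NUM along line `lattice` must PROVE `SaturationAtThree` there (equivalently
SIGN of line `correspondence`, `CartanTransportSatOfSign`); at cuspidal places it is automatic (`CartanSupply.CuspNoFixed`). Numerically (D4) holds in
all 89 computed PS cases (saturation index `1`) and NUM in 752∕752 (class, place) pairs (`run/shared/lean/pub/bsd-stepL/tam3-p1/g24/CDEG3-RESULT.md`):
(D4) is the research kernel of the line, not a suspected falsehood. (ii) (D3) is likewise not absorbable. (iii) Scope: these are models of the
ABSTRACT contract; whether the geometric lattice `𝕃 = Hom(J_R, W₁)` can realise the `M`-type form is precisely the content of (D4).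
HONEST FRAMING. Finite-group algebra over `ℤ` on top of the tree's cartan-f2a ∕ tam3-p1 files (mod-3 line, S-K1′, supply lattice, coordinate
transport); the one new observation is that the mod-3 line built in cartan-f2a to PROVE S-K1′ is itself a counter-model to the unsaturated contract —
S-K1′'s `+1` (about `Λ` and its generators) and the dictionary's `+1` (about primitive vectors of whatever lattice the geometry supplies) differ
exactly by the position of that lattice in the pair `{Λ, K}`. No new Mathlib-level mathematics. [folklore]
-/

set_option linter.dupNamespace false
set_option autoImplicit false

noncomputable section

open scoped Classical

namespace Summit.BirchSwinnertonDyer.BirchSwinnertonDyer.Theorems.CartanOnePlaceDegreeLawAtThreeNegative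

open Summit.BirchSwinnertonDyer.BirchSwinnertonDyer.Theorems
open CartanDegree CartanTorusCubeCut CartanCover

/-! ## §1 Generic: a subgroup `K` of `ℤ^d` containing `3ℤ^d` — rank `d`, and a representation on it acting as `ρ` has the trace of `ρ` -/
section Generic

variable {Gp : Type*} [Group Gp] {d : ℕ} (ρ : Representation ℤ Gp (Fin d → ℤ)) (K : Submodule ℤ (Fin d → ℤ))

/-- A subgroup of `ℤ^d` containing `3ℤ^d` has rank `d`. -/
theorem finrank_eq_of_three_smul_mem (h3 : ∀ v : Fin d → ℤ, (3 : ℤ) • v ∈ K) : Module.finrank ℤ K = d := by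
  apply le_antisymm
  · simpa using Submodule.finrank_le K
  · let τ : (Fin d → ℤ) →ₗ[ℤ] K := LinearMap.codRestrict K ((3 : ℤ) • LinearMap.id) (fun v => h3 v)
    have hτ : Function.Injective τ := by
      intro v w hvw
      have h := congrArg (fun x : K => (x : Fin d → ℤ)) hvw
      simp only [τ, LinearMap.codRestrict_apply, LinearMap.smul_apply, LinearMap.id_apply] at h
      exact smul_right_injective _ (by norm_num) h
    simpa using LinearMap.finrank_le_finrank_of_injective hτ

/-- Finite index does not change the character: `tr ρ_K = tr ρ` for a representation `ρ_K` on `K ⊇ 3ℤ^d` acting as `ρ` on vectors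
(`3·tr ρ_K = tr(τ∘ι∘ρ_K) = tr(ι∘ρ_K∘τ) = tr(3ρ)` for `ι` the inclusion and `τ = 3·(−) : ℤ^d → K`, then cancel `3` in `ℤ`). -/
theorem trace_eq_of_three_smul_mem (ρK : Representation ℤ Gp K) (hρK : ∀ (g : Gp) (v : K), ((ρK g v : K) : Fin d → ℤ) = ρ g v)
    (h3 : ∀ v : Fin d → ℤ, (3 : ℤ) • v ∈ K) (g : Gp) :
    LinearMap.trace ℤ K (ρK g) = LinearMap.trace ℤ (Fin d → ℤ) (ρ g) := by
  let τ : (Fin d → ℤ) →ₗ[ℤ] K := LinearMap.codRestrict K ((3 : ℤ) • LinearMap.id) (fun v => h3 v)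
  have hτ : ∀ v, ((τ v : K) : Fin d → ℤ) = (3 : ℤ) • v := fun v => rfl
  have h1 : τ ∘ₗ (K.subtype ∘ₗ ρK g) = (3 : ℤ) • ρK g := by
    apply LinearMap.ext; intro v; apply Subtype.ext
    rw [LinearMap.comp_apply, LinearMap.comp_apply, hτ, Submodule.subtype_apply, LinearMap.smul_apply, Submodule.coe_smul]
  have h2 : (K.subtype ∘ₗ ρK g) ∘ₗ τ = (3 : ℤ) • ρ g := by
    apply LinearMap.ext; intro v
    rw [LinearMap.comp_apply, LinearMap.comp_apply, Submodule.subtype_apply, hρK, hτ, map_smul, LinearMap.smul_apply]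
  have h := LinearMap.trace_comp_comm' (K.subtype ∘ₗ ρK g) τ
  rw [h1, h2, map_smul, map_smul, smul_eq_mul, smul_eq_mul] at h
  exact mul_left_cancel₀ (by norm_num : (3 : ℤ) ≠ 0) h

end Generic

/-! ## §2 The full contract implies the law (tree) -/
section Contract

/-- PROVED (the tree's positive contract, for contrast) — **with ALL clauses, the lattice contract forces `ord₃ degX0 = ord₃ degC + 1`**:
`CartanPreDatumOfLattice.exists_degreeData_of_lattice` builds a `CartanTorusDegreeData` with these degrees and S-K1′
(`CartanF2bResidue.latticeDegreeLawAtThree`) gives the law. [folklore] -/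
theorem latticeLaw_with_saturation (q : ℕ) [Fact q.Prime] (hq3 : q ≠ 3) (d : ℕ) (ρ : Representation ℤ (G q) (Fin d → ℤ))
    (trace_eq : ∀ g, LinearMap.trace ℤ (Fin d → ℤ) (ρ g) = cubicNewvectorChar q g)
    (noFixed : ∀ v : Fin d → ℤ, (∀ g, ∃ w : Fin d → ℤ, ρ g v - v = (3 : ℤ) • w) → ∃ w : Fin d → ℤ, v = (3 : ℤ) • w)
    (B : (Fin d → ℤ) →ₗ[ℤ] (Fin d → ℤ) →ₗ[ℤ] ℤ) (B_symm : ∀ x y, B x y = B y x) (B_pos : ∀ x, x ≠ 0 → 0 < B x x)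
    (B_inv : ∀ g x y, B (ρ g x) (ρ g y) = B x y) (η : Mat q) (hη : ¬ HasRatEigenvalue η) (uS uC : Fin d → ℤ)
    (huS : ∀ g : G q, (g : Mat q) 0 1 = 0 → (g : Mat q) 1 0 = 0 → ρ g uS = uS)
    (huC : ∀ g : G q, (g : Mat q) * η = η * g → ρ g uC = uC)
    (h3S : ¬ ∃ v : Fin d → ℤ, uS = (3 : ℤ) • v) (h3C : ¬ ∃ v : Fin d → ℤ, uC = (3 : ℤ) • v)
    (c : ℚ) (hc : 0 < c) (degX0 degC : ℕ) (hX0 : 0 < degX0) (hC0 : 0 < degC)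
    (sheet_s : c * ((B uS uS : ℤ) : ℚ) = ((q : ℚ) - 1) ^ 2 / 2 * (degX0 : ℚ))
    (sheet_C : c * ((B uC uC : ℤ) : ℚ) = ((q : ℚ) ^ 2 - 1) / 2 * (degC : ℚ)) :
    padicValNat 3 degX0 = padicValNat 3 degC + 1 := by
  let 𝓛 : CartanTorusLattice q :=
    { d := d, ρ := ρ, trace_eq := trace_eq, B := B, B_symm := B_symm, B_pos := B_pos, B_inv := B_inv,
      noFixedVectorModThree := noFixed, η := η, η_irred := hη }
  obtain ⟨𝒟, -, h1, h2⟩ := CartanPreDatumOfLattice.exists_degreeData_of_lattice hq3 𝓛 c hc uS uC huS huC h3S h3C degX0 degC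
    hX0 hC0 sheet_s sheet_C
  have h := CartanF2bResidue.latticeDegreeLawAtThree q Fact.out hq3 𝒟
  rwa [h1, h2] at h

end Contract

/-! ## §3 The common witness arithmetic: `c = (q−1)²(q²−1)∕2`, `degX0 = B(w_S,w_S)·(q²−1)`, `degC = 9·B(w_C,w_C)·(q−1)²` -/
section Arith

variable {q : ℕ}

/-- PROVED — for a Cartan torus lattice `Λ` with torus generators `w_S`, `w_C` and the vectors `w_S`, `3w_C`: the normalisation
`c = (q−1)²(q²−1)∕2 > 0` and the degrees `degX0 = B(w_S,w_S)(q²−1) > 0`, `degC = 9B(w_C,w_C)(q−1)² > 0` satisfy both sheet counts, and S-K1′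
(`CartanF2bResidue.cubicTorusPeriodRatioAtThree`: `ord₃ B(w_S,w_S) + ord₃(q+1) = ord₃ B(w_C,w_C) + 1 + ord₃(q−1)`) makes the law come out INVERTED:
`ord₃ degX0 + 1 = ord₃ degC`. [folklore] -/
theorem witness_arith (hq : q.Prime) (hq3 : q ≠ 3) (𝓛 : CartanTorusLattice q) (wS wC : Fin 𝓛.d → ℤ)
    (hS : 𝓛.IsSplitFixed wS) (hC : 𝓛.IsNonsplitFixed wC)
    (hSgen : ∀ v, 𝓛.IsSplitFixed v → ∃ m : ℤ, v = m • wS) (hCgen : ∀ v, 𝓛.IsNonsplitFixed v → ∃ m : ℤ, v = m • wC)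
    (hwS : wS ≠ 0) (hwC : wC ≠ 0) :
    0 < ((q : ℚ) - 1) ^ 2 * ((q : ℚ) ^ 2 - 1) / 2 ∧
    0 < (𝓛.B wS wS).natAbs * (q ^ 2 - 1) ∧ 0 < 9 * (𝓛.B wC wC).natAbs * (q - 1) ^ 2 ∧
    ((q : ℚ) - 1) ^ 2 * ((q : ℚ) ^ 2 - 1) / 2 * ((𝓛.B wS wS : ℤ) : ℚ) =
      ((q : ℚ) - 1) ^ 2 / 2 * (((𝓛.B wS wS).natAbs * (q ^ 2 - 1) : ℕ) : ℚ) ∧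
    ((q : ℚ) - 1) ^ 2 * ((q : ℚ) ^ 2 - 1) / 2 * ((𝓛.B ((3 : ℤ) • wC) ((3 : ℤ) • wC) : ℤ) : ℚ) =
      ((q : ℚ) ^ 2 - 1) / 2 * ((9 * (𝓛.B wC wC).natAbs * (q - 1) ^ 2 : ℕ) : ℚ) ∧
    padicValNat 3 ((𝓛.B wS wS).natAbs * (q ^ 2 - 1)) + 1 = padicValNat 3 (9 * (𝓛.B wC wC).natAbs * (q - 1) ^ 2) := by
  haveI : Fact (Nat.Prime 3) := ⟨Nat.prime_three⟩
  have hbS : 0 < 𝓛.B wS wS := 𝓛.B_pos wS hwS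
  have hbC : 0 < 𝓛.B wC wC := 𝓛.B_pos wC hwC
  set bS : ℕ := (𝓛.B wS wS).natAbs with hbS_def
  set bC : ℕ := (𝓛.B wC wC).natAbs with hbC_def
  have hbSZ : (bS : ℤ) = 𝓛.B wS wS := Int.natAbs_of_nonneg hbS.le
  have hbCZ : (bC : ℤ) = 𝓛.B wC wC := Int.natAbs_of_nonneg hbC.le
  have hbS0 : bS ≠ 0 := Int.natAbs_ne_zero.mpr hbS.ne'
  have hbC0 : bC ≠ 0 := Int.natAbs_ne_zero.mpr hbC.ne'
  have hq1 : 1 ≤ q := hq.one_lt.le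
  have hqm1 : q - 1 ≠ 0 := by have := hq.two_le; omega
  have hqp1 : q + 1 ≠ 0 := by omega
  have hsq : q ^ 2 - 1 = (q + 1) * (q - 1) := by simpa using Nat.sq_sub_sq q 1
  have hq21 : q ^ 2 - 1 ≠ 0 := by rw [hsq]; exact mul_ne_zero hqp1 hqm1
  have hq2 : 1 ≤ q ^ 2 := by nlinarith
  have hBC : 𝓛.B ((3 : ℤ) • wC) ((3 : ℤ) • wC) = 9 * 𝓛.B wC wC := by
    simp only [map_smul, LinearMap.smul_apply, smul_eq_mul]; ring
  refine ⟨?_, ?_, ?_, ?_, ?_, ?_⟩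
  · have hq1Q : (1 : ℚ) < q := by exact_mod_cast hq.one_lt
    exact div_pos (mul_pos (pow_pos (by linarith) 2) (by nlinarith)) two_pos
  · exact Nat.pos_of_ne_zero (mul_ne_zero hbS0 hq21)
  · exact Nat.pos_of_ne_zero (mul_ne_zero (mul_ne_zero (by norm_num) hbC0) (pow_ne_zero 2 hqm1))
  · rw [← hbSZ]; push_cast [Nat.cast_sub hq2]; ring
  · rw [hBC, ← hbCZ]; push_cast [Nat.cast_sub hq1]; ring
  · have hSK := CartanF2bResidue.cubicTorusPeriodRatioAtThree q hq hq3 𝓛 wS wC hS hSgen hC hCgen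
    have hvS : padicValInt 3 (𝓛.B wS wS) = padicValNat 3 bS := rfl
    have hvC : padicValInt 3 (𝓛.B wC wC) = padicValNat 3 bC := rfl
    rw [hvS, hvC] at hSK
    have h9 : padicValNat 3 9 = 2 := by
      rw [show (9 : ℕ) = 3 ^ 2 by norm_num, padicValNat.prime_pow]
    rw [hsq, padicValNat.mul hbS0 (mul_ne_zero hqp1 hqm1), padicValNat.mul hqp1 hqm1,
      padicValNat.mul (mul_ne_zero (by norm_num) hbC0) (pow_ne_zero 2 hqm1), padicValNat.mul (by norm_num) hbC0,
      pow_two, padicValNat.mul hqm1 hqm1, h9]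
    omega

end Arith

/-! ## §4 (D3) is load-bearing: `u_C := 3w_C` in the lattice itself -/
section Descent

variable {q : ℕ} [Fact q.Prime]

/-- PROVED — **inverted law from a non-primitive `u_C`.** In ANY Cartan torus lattice `Λ` at a prime `q ≠ 3` (saturation clause included), the vectors
`u_S := w_S`, `u_C := 3w_C` satisfy every clause of the contract except «`u_C ∉ 3Λ`», with the law inverted. [folklore] -/
theorem exists_invertedLaw_in_lattice (hq3 : q ≠ 3) (𝓛 : CartanTorusLattice q) (wS wC : Fin 𝓛.d → ℤ)
    (hS : 𝓛.IsSplitFixed wS) (hC : 𝓛.IsNonsplitFixed wC)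
    (hSgen : ∀ v, 𝓛.IsSplitFixed v → ∃ m : ℤ, v = m • wS) (hCgen : ∀ v, 𝓛.IsNonsplitFixed v → ∃ m : ℤ, v = m • wC)
    (hwS : wS ≠ 0) (hwC : wC ≠ 0) :
    ∃ (uS uC : Fin 𝓛.d → ℤ) (c : ℚ) (degX0 degC : ℕ),
      𝓛.IsSplitFixed uS ∧ 𝓛.IsNonsplitFixed uC ∧ (¬ ∃ v : Fin 𝓛.d → ℤ, uS = (3 : ℤ) • v) ∧
      0 < c ∧ 0 < degX0 ∧ 0 < degC ∧
      c * ((𝓛.B uS uS : ℤ) : ℚ) = ((q : ℚ) - 1) ^ 2 / 2 * (degX0 : ℚ) ∧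
      c * ((𝓛.B uC uC : ℤ) : ℚ) = ((q : ℚ) ^ 2 - 1) / 2 * (degC : ℚ) ∧
      padicValNat 3 degX0 + 1 = padicValNat 3 degC := by
  have hq : q.Prime := Fact.out
  obtain ⟨hc, hX0, hC0, hsS, hsC, hlaw⟩ := witness_arith hq hq3 𝓛 wS wC hS hC hSgen hCgen hwS hwC
  refine ⟨wS, (3 : ℤ) • wC, _, _, _, hS, ?_, PS.wS_not_three_smul 𝓛 hwS hSgen hS, hc, hX0, hC0, hsS, hsC, hlaw⟩
  intro g hg
  rw [map_smul, hC g hg]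

/-- PROVED — **(D3) `DescentNonsplitAtThree` IS LOAD-BEARING: the lattice contract with ONLY the clause «`u_C ∉ 3Λ`» removed is FALSE.** The negated
statement below is the contract of `latticeLaw_with_saturation` verbatim minus the hypothesis `h3C`. Witness: the supply lattice at `q = 7`
(`CartanSupply.Monomial.cartanTorusLatticeSupply_holds`) with `u_C := 3w_C` (`exists_invertedLaw_in_lattice`). [folklore] -/
theorem latticeLaw_false_without_descent :
    ¬ ∀ (q : ℕ) [Fact q.Prime], q ≠ 3 → ∀ (d : ℕ) (ρ : Representation ℤ (G q) (Fin d → ℤ)),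
        (∀ g, LinearMap.trace ℤ (Fin d → ℤ) (ρ g) = cubicNewvectorChar q g) →
        (∀ v : Fin d → ℤ, (∀ g, ∃ w : Fin d → ℤ, ρ g v - v = (3 : ℤ) • w) → ∃ w : Fin d → ℤ, v = (3 : ℤ) • w) →
        ∀ (B : (Fin d → ℤ) →ₗ[ℤ] (Fin d → ℤ) →ₗ[ℤ] ℤ), (∀ x y, B x y = B y x) → (∀ x, x ≠ 0 → 0 < B x x) →
          (∀ g x y, B (ρ g x) (ρ g y) = B x y) →
        ∀ (η : Mat q), ¬ HasRatEigenvalue η →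
        ∀ (uS uC : Fin d → ℤ),
          (∀ g : G q, (g : Mat q) 0 1 = 0 → (g : Mat q) 1 0 = 0 → ρ g uS = uS) →
          (∀ g : G q, (g : Mat q) * η = η * g → ρ g uC = uC) →
          (¬ ∃ v : Fin d → ℤ, uS = (3 : ℤ) • v) →
        ∀ (c : ℚ), 0 < c → ∀ (degX0 degC : ℕ), 0 < degX0 → 0 < degC →
          c * ((B uS uS : ℤ) : ℚ) = ((q : ℚ) - 1) ^ 2 / 2 * (degX0 : ℚ) →
          c * ((B uC uC : ℤ) : ℚ) = ((q : ℚ) ^ 2 - 1) / 2 * (degC : ℚ) →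
          padicValNat 3 degX0 = padicValNat 3 degC + 1 := by
  intro h
  haveI : Fact (Nat.Prime 7) := ⟨by norm_num⟩
  obtain ⟨𝓛, wS, wC, hS, hC, hSgen, hCgen, hwS, hwC⟩ :=
    CartanSupply.Monomial.cartanTorusLatticeSupply_holds 7 (by norm_num) (by norm_num)
  obtain ⟨uS, uC, c, degX0, degC, huS, huC, h3S, hc, hX0, hC0, hsS, hsC, hlaw⟩ :=
    exists_invertedLaw_in_lattice (q := 7) (by norm_num) 𝓛 wS wC hS hC hSgen hCgen hwS hwC
  have := h 7 (by norm_num) 𝓛.d 𝓛.ρ 𝓛.trace_eq 𝓛.noFixedVectorModThree 𝓛.B 𝓛.B_symm 𝓛.B_pos 𝓛.B_inv 𝓛.η 𝓛.η_irred uS uC huS huC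
    h3S c hc degX0 degC hX0 hC0 hsS hsC
  omega

end Descent

/-! ## §5 (D4) is load-bearing: the mod-3 line `K = X_M ⊂ Λ` (the other `ℤ`-form) at `q ≡ 1 (mod 3)` -/
section Saturation

variable {q : ℕ} [Fact q.Prime]

/-- PROVED — **THE INVERTED LAW ON THE OTHER `ℤ`-FORM.** Let `q ≡ 1 (mod 3)`, `q ≥ 5`, `Λ` a Cartan torus lattice (so `(Λ∕3Λ)^G = 0`) with torus
generators `w_S`, `w_C`, and `K ⊂ Λ` its mod-3 line (`CartanTorusCubeCut.PSMod.exists_line`: `G`-stable, `3Λ ⊆ K`, `G` trivial on `Λ∕K ≠ 0`; then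
`w_S ∈ K` by `PS.wS_mem` and `w_C ∉ K` by `PS.wC_not_mem`). In coordinates `K ≅ ℤ^d` (`Module.finBasisOfFinrankEq`, `CartanCover.coordRep`) the restricted
representation has the SAME character `cubicNewvectorChar q` (`trace_eq_of_three_smul_mem`), carries the restricted invariant form and the same `η`, the
torus-fixed vectors `u_S = w_S` and `u_C = 3w_C`, NEITHER divisible by `3` in `K` (`PS.wS_not_three_smul`; `w_C ∉ K`), the normalisation and degrees of
`witness_arith` with both sheet counts — and `u_C` is `G`-fixed modulo `3K` (the clause (D4) fails for `K`), while the law is INVERTED: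
`ord₃ degX0 + 1 = ord₃ degC`. [folklore] -/
theorem exists_invertedLaw_of_cartanTorusLattice (hq5 : 5 ≤ q) (h1 : q % 3 = 1) (𝓛 : CartanTorusLattice q)
    (wS wC : Fin 𝓛.d → ℤ) (hS : 𝓛.IsSplitFixed wS) (hC : 𝓛.IsNonsplitFixed wC)
    (hSgen : ∀ v, 𝓛.IsSplitFixed v → ∃ m : ℤ, v = m • wS) (hCgen : ∀ v, 𝓛.IsNonsplitFixed v → ∃ m : ℤ, v = m • wC)
    (hwS : wS ≠ 0) (hwC : wC ≠ 0) :
    ∃ (ρ' : Representation ℤ (G q) (Fin 𝓛.d → ℤ)) (B' : (Fin 𝓛.d → ℤ) →ₗ[ℤ] (Fin 𝓛.d → ℤ) →ₗ[ℤ] ℤ)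
      (uS uC : Fin 𝓛.d → ℤ) (c : ℚ) (degX0 degC : ℕ),
      (∀ g, LinearMap.trace ℤ (Fin 𝓛.d → ℤ) (ρ' g) = cubicNewvectorChar q g) ∧
      (∀ x y, B' x y = B' y x) ∧ (∀ x, x ≠ 0 → 0 < B' x x) ∧ (∀ g x y, B' (ρ' g x) (ρ' g y) = B' x y) ∧
      (∀ g : G q, (g : Mat q) 0 1 = 0 → (g : Mat q) 1 0 = 0 → ρ' g uS = uS) ∧
      (∀ g : G q, (g : Mat q) * 𝓛.η = 𝓛.η * g → ρ' g uC = uC) ∧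
      (¬ ∃ v : Fin 𝓛.d → ℤ, uS = (3 : ℤ) • v) ∧ (¬ ∃ v : Fin 𝓛.d → ℤ, uC = (3 : ℤ) • v) ∧
      (uC ≠ 0 ∧ ∀ g, ∃ w : Fin 𝓛.d → ℤ, ρ' g uC - uC = (3 : ℤ) • w) ∧
      0 < c ∧ 0 < degX0 ∧ 0 < degC ∧
      c * ((B' uS uS : ℤ) : ℚ) = ((q : ℚ) - 1) ^ 2 / 2 * (degX0 : ℚ) ∧
      c * ((B' uC uC : ℤ) : ℚ) = ((q : ℚ) ^ 2 - 1) / 2 * (degC : ℚ) ∧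
      padicValNat 3 degX0 + 1 = padicValNat 3 degC := by
  have hq : q.Prime := Fact.out
  have hq3 : q ≠ 3 := by omega
  -- the mod-3 line `K`
  obtain ⟨K, hline, -, -, -, -⟩ := PSMod.exists_line hq5 h1 𝓛
  have hstab := hline.1
  have h3 := hline.2.1
  have htriv := hline.2.2.1
  have hwSK : wS ∈ K := PS.wS_mem 𝓛 hline h1 (PS.exists_unipotent_sum_eq_zero 𝓛 h1 hS hSgen)
  have hwCK : wC ∉ K := PS.wC_not_mem 𝓛 hline h1 hCgen
  have hwS3 : ¬ ∃ w, wS = (3 : ℤ) • w := PS.wS_not_three_smul 𝓛 hwS hSgen hS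
  -- coordinates `e : K ≅ ℤ^d`, transported representation and form
  let e : K ≃ₗ[ℤ] (Fin 𝓛.d → ℤ) := (Module.finBasisOfFinrankEq ℤ K (finrank_eq_of_three_smul_mem K h3)).equivFun
  let ρK : Representation ℤ (G q) K :=
    { toFun := fun g => (𝓛.ρ g).restrict (hstab g)
      map_one' := by
        apply LinearMap.ext; intro v; apply Subtype.ext
        simp [LinearMap.restrict_apply]
      map_mul' := fun g h => by
        apply LinearMap.ext; intro v; apply Subtype.ext
        simp [LinearMap.restrict_apply, map_mul] }
  have hρK : ∀ (g : G q) (v : K), ((ρK g v : K) : Fin 𝓛.d → ℤ) = 𝓛.ρ g v := fun g v => rfl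
  let ρ' : Representation ℤ (G q) (Fin 𝓛.d → ℤ) := coordRep e ρK
  let ι : (Fin 𝓛.d → ℤ) →ₗ[ℤ] (Fin 𝓛.d → ℤ) := K.subtype ∘ₗ e.symm.toLinearMap
  let B' : (Fin 𝓛.d → ℤ) →ₗ[ℤ] (Fin 𝓛.d → ℤ) →ₗ[ℤ] ℤ := 𝓛.B.compl₁₂ ι ι
  have hB' : ∀ x y, B' x y = 𝓛.B ((e.symm x : K) : Fin 𝓛.d → ℤ) ((e.symm y : K) : Fin 𝓛.d → ℤ) := fun x y => rfl
  have hι_ρ' : ∀ (g : G q) (x : Fin 𝓛.d → ℤ),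
      ((e.symm (ρ' g x) : K) : Fin 𝓛.d → ℤ) = 𝓛.ρ g ((e.symm x : K) : Fin 𝓛.d → ℤ) := by
    intro g x
    show ((e.symm (coordRep e ρK g x) : K) : Fin 𝓛.d → ℤ) = _
    rw [coordRep_apply, LinearEquiv.symm_apply_apply, hρK]
  -- the two vectors
  let xS : K := ⟨wS, hwSK⟩
  let xC : K := ⟨(3 : ℤ) • wC, h3 wC⟩
  let uS : Fin 𝓛.d → ℤ := e xS
  let uC : Fin 𝓛.d → ℤ := e xC
  have huSe : e.symm uS = xS := LinearEquiv.symm_apply_apply e xS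
  have huCe : e.symm uC = xC := LinearEquiv.symm_apply_apply e xC
  have hBS : B' uS uS = 𝓛.B wS wS := by rw [hB', huSe]
  have hBC : B' uC uC = 𝓛.B ((3 : ℤ) • wC) ((3 : ℤ) • wC) := by rw [hB', huCe]
  obtain ⟨hc, hX0, hC0, hsS, hsC, hlaw⟩ := witness_arith hq hq3 𝓛 wS wC hS hC hSgen hCgen hwS hwC
  refine ⟨ρ', B', uS, uC, _, _, _, ?_, ?_, ?_, ?_, ?_, ?_, ?_, ?_, ⟨?_, ?_⟩, hc, hX0, hC0, ?_, ?_, hlaw⟩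
  · -- character
    intro g
    rw [trace_coordRep, trace_eq_of_three_smul_mem 𝓛.ρ K ρK hρK h3, 𝓛.trace_eq]
  · -- symmetry
    intro x y; rw [hB', hB', 𝓛.B_symm]
  · -- positivity
    intro x hx
    rw [hB']
    apply 𝓛.B_pos
    intro h0
    apply hx
    have : (e.symm x : K) = 0 := Subtype.ext h0
    simpa using congrArg e this
  · -- invariance
    intro g x y; rw [hB', hB', hι_ρ', hι_ρ', 𝓛.B_inv]
  · -- `u_S` is split-torus fixed
    intro g h01 h10
    show coordRep e ρK g (e xS) = e xS
    rw [coordRep_apply_eq_self_iff]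
    exact Subtype.ext (hS g h01 h10)
  · -- `u_C` is non-split-torus fixed
    intro g hg
    show coordRep e ρK g (e xC) = e xC
    rw [coordRep_apply_eq_self_iff]
    apply Subtype.ext
    show 𝓛.ρ g ((3 : ℤ) • wC) = (3 : ℤ) • wC
    rw [map_smul, hC g hg]
  · -- `u_S ∉ 3K` (as `w_S ∉ 3Λ`)
    intro h
    obtain ⟨w, hw⟩ := (exists_eq_three_smul_iff e xS).mp h
    exact hwS3 ⟨(w : Fin 𝓛.d → ℤ), by simpa [xS] using congrArg Subtype.val hw⟩
  · -- `u_C = 3w_C ∉ 3K` (as `w_C ∉ K`)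
    intro h
    obtain ⟨w, hw⟩ := (exists_eq_three_smul_iff e xC).mp h
    have h' : (3 : ℤ) • wC = (3 : ℤ) • (w : Fin 𝓛.d → ℤ) := by simpa [xC] using congrArg Subtype.val hw
    have : wC = (w : Fin 𝓛.d → ℤ) := smul_right_injective _ (by norm_num) h'
    exact hwCK (this ▸ w.2)
  · -- `u_C ≠ 0`
    intro h0
    have : xC = 0 := by simpa [uC] using h0
    have h' : (3 : ℤ) • wC = 0 := congrArg Subtype.val this
    exact hwC ((smul_eq_zero.mp h').resolve_left (by norm_num))
  · -- `u_C` is `G`-fixed modulo `3K`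
    intro g
    refine ⟨e ⟨𝓛.ρ g wC - wC, htriv g wC⟩, ?_⟩
    show coordRep e ρK g (e xC) - e xC = _
    rw [coordRep_apply_coe, ← map_sub, ← map_zsmul]
    congr 1
    apply Subtype.ext
    show 𝓛.ρ g ((3 : ℤ) • wC) - (3 : ℤ) • wC = (3 : ℤ) • (𝓛.ρ g wC - wC)
    rw [map_smul, smul_sub]
  · rwa [hBS]
  · rwa [hBC]

/-- PROVED — **(D4) `SaturationAtThree` IS LOAD-BEARING: the lattice contract with ONLY the clause «`(Λ∕3Λ)^G = 0`» removed is FALSE.** The negated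
statement below is the contract of `latticeLaw_with_saturation` verbatim minus the hypothesis `noFixed`. Witness: the mod-3 line of the supply
lattice at `q = 7` (`CartanSupply.Monomial.cartanTorusLatticeSupply_holds`, `exists_invertedLaw_of_cartanTorusLattice`). Consequence for line
`lattice` of crux `CartanOnePlaceDegreeLawAtThree`: (A)+(M)+(P+T)+(D3) do not imply NUM through the dictionary; (D4) must be proved at every
principal-series place `q ≡ 1 (mod 3)` (it is automatic at cuspidal places). [folklore] -/
theorem latticeLaw_false_without_saturation :
    ¬ ∀ (q : ℕ) [Fact q.Prime], q ≠ 3 → ∀ (d : ℕ) (ρ : Representation ℤ (G q) (Fin d → ℤ)),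
        (∀ g, LinearMap.trace ℤ (Fin d → ℤ) (ρ g) = cubicNewvectorChar q g) →
        ∀ (B : (Fin d → ℤ) →ₗ[ℤ] (Fin d → ℤ) →ₗ[ℤ] ℤ), (∀ x y, B x y = B y x) → (∀ x, x ≠ 0 → 0 < B x x) →
          (∀ g x y, B (ρ g x) (ρ g y) = B x y) →
        ∀ (η : Mat q), ¬ HasRatEigenvalue η →
        ∀ (uS uC : Fin d → ℤ),
          (∀ g : G q, (g : Mat q) 0 1 = 0 → (g : Mat q) 1 0 = 0 → ρ g uS = uS) →
          (∀ g : G q, (g : Mat q) * η = η * g → ρ g uC = uC) →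
          (¬ ∃ v : Fin d → ℤ, uS = (3 : ℤ) • v) → (¬ ∃ v : Fin d → ℤ, uC = (3 : ℤ) • v) →
        ∀ (c : ℚ), 0 < c → ∀ (degX0 degC : ℕ), 0 < degX0 → 0 < degC →
          c * ((B uS uS : ℤ) : ℚ) = ((q : ℚ) - 1) ^ 2 / 2 * (degX0 : ℚ) →
          c * ((B uC uC : ℤ) : ℚ) = ((q : ℚ) ^ 2 - 1) / 2 * (degC : ℚ) →
          padicValNat 3 degX0 = padicValNat 3 degC + 1 := by
  intro h
  haveI : Fact (Nat.Prime 7) := ⟨by norm_num⟩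
  obtain ⟨𝓛, wS, wC, hS, hC, hSgen, hCgen, hwS, hwC⟩ :=
    CartanSupply.Monomial.cartanTorusLatticeSupply_holds 7 (by norm_num) (by norm_num)
  obtain ⟨ρ', B', uS, uC, c, degX0, degC, htr, hsy, hpos, hinv, huS, huC, h3S, h3C, -, hc, hX0, hC0, hsS, hsC, hlaw⟩ :=
    exists_invertedLaw_of_cartanTorusLattice (q := 7) (by norm_num) (by norm_num) 𝓛 wS wC hS hC hSgen hCgen hwS hwC
  have := h 7 (by norm_num) 𝓛.d ρ' htr B' hsy hpos hinv 𝓛.η 𝓛.η_irred uS uC huS huC h3S h3C c hc degX0 degC hX0 hC0 hsS hsC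
  omega

end Saturation

end Summit.BirchSwinnertonDyer.BirchSwinnertonDyer.Theorems.CartanOnePlaceDegreeLawAtThreeNegative
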